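import Summits.CriticalPhenomena.CardyFormulaZ2.Theorems.CardyIKTransportIKLinearTransportStubPinnedExchange
import Summits.CriticalPhenomena.CardyFormulaZ2.Theorems.CardyIKTransportIKLinearTransportStubCouplingToLimitsEvents
import Summits.CriticalPhenomena.CardyFormulaZ2.Theorems.CardyIKTransportIKMixedBoxCrossingDefs
import Summits.CriticalPhenomena.CardyFormulaZ2.Theorems.CardyIKTransportIKMixedBoxCrossingStubDuality

/-!
# Stub `stub_patternLocality` (line `paired-mirror-exploration`, crux `IKMixedBoxCrossing`,
# stmt-CriticalPhenomena-5911)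

The box-crossing probabilities `pLR S a b w h`, `pTB S a b w h` of the column-mixed IK gauge depend on
`(S, a, b)` only through the column pattern `i ↦ (a + i ∈ S)`, `i < w`.  Three ingredients:

* HORIZONTAL RE-ANCHORING (`exists_lift_hshift`, the `x`-analogue of the landed `exists_lift_vshift`):
  a `μIK`-preserving map of the bit space lifting the horizontal shift of the observables (shift the
  column bits, plaquettes and coins; correct the ROW bits by the parity of the plaquettes in the
  rectangles `[min 0 (-m), max 0 (-m)) × [min 0 y, max 0 y)`), together with the pattern shift
  `S ↦ {x | x - m ∈ S}`;
* SHIFT COVARIANCE of the box events (`shiftObs_mem_lrCross` / `shiftObs_mem_tbCross`): the open edge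
  set of the shifted observables is the translate of the open edge set (`blackEdges_shiftObs`), and open
  crossings are transported along the translation (`preimage_relabel_openCrossing`);
* ORIGIN PATTERN LOCALITY (`obs_mem_cross_congr`, pointwise): the box events of the box `[0, w) × [b, b+h)`
  read the colours of the box cells and the diagonal flags of the faces in the columns `0 … w-1`, which
  for the gauge anchored at the origin only involve the pattern of `S` on `[0, w)`.
-/

noncomputable section

namespace Summit.CriticalPhenomena.CardyFormulaZ2.Cruxes.IKMixedBoxCrossing.PairedMirrorExploration

open scoped Classical symmDiff
open MeasureTheory Set Function
open Literature.Probability.Percolation Literature.Probability.LatticeModels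
open Summit.CriticalPhenomena.CardyFormulaZ2.Theorems.IKLinearTransport.PinnedDiagramExchange
open Summit.CriticalPhenomena.CardyFormulaZ2.Theorems.IKQuarterTurn (measurePreserving_relabel)

namespace StubPatternLocality

/-! ## §A Shifts of observables and shift covariance of the box events -/

/-- Shift of an observable configuration by the lattice vector `t` (so that `vshift m = shiftObs ![0, m]`).
[folklore] -/
def shiftObs (t : Site 2) (x : Obs) : Obs := ((fun v => v - t) ⁻¹' x.1, (fun v => v - t) ⁻¹' x.2)

/-- The landed vertical shift is the shift by `![0, m]`. [folklore] -/
theorem vshift_eq_shiftObs (m : ℤ) : vshift m = shiftObs ![0, m] := rfl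

/-- The open edge set of the shifted observables is the translate of the open edge set. [folklore] -/
theorem blackEdges_shiftObs (t : Site 2) (x : Obs) :
    blackEdges (shiftObs t x) = BondConfig.relabel (sym2Equiv (Equiv.addRight t)) (blackEdges x) := by
  ext e
  induction e using Sym2.ind with
  | h u v =>
    rw [BondConfig.mem_relabel_iff, sym2Equiv_symm, Equiv.addRight_symm, sym2Equiv_mk,
      CouplingToLimits.mk_mem_blackEdges_iff, CouplingToLimits.mk_mem_blackEdges_iff]
    have h1 : ∀ (p q : Site 2) (d : Site 2), p - t = q - t + d ↔ p = q + d := fun p q d => by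
      rw [sub_add_eq_add_sub, sub_left_inj]
    have h2 : ∀ p : Site 2, p - t + ![0, -1] = p + ![0, -1] - t := fun p => by abel
    simp only [shiftObs, Set.mem_preimage, Equiv.coe_addRight, ← sub_eq_add_neg, h1, h2]

/-- Translating the cells of a set described by its two coordinates. [folklore] -/
theorem image_addRight_setOf (t : Site 2) (p : ℤ → ℤ → Prop) :
    (Equiv.addRight t) '' {v : Site 2 | p (v 0) (v 1)} = {v | p (v 0 - t 0) (v 1 - t 1)} := by
  rw [Equiv.image_eq_preimage_symm]
  ext v
  simp only [Set.mem_preimage, Equiv.addRight_symm, Equiv.coe_addRight, Set.mem_setOf_eq,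
    ← sub_eq_add_neg, Pi.sub_apply]

/-- SHIFT COVARIANCE of the left–right box crossing. [folklore] -/
theorem shiftObs_mem_lrCross (t : Site 2) (a b : ℤ) (w h : ℕ) (x : Obs) :
    shiftObs t x ∈ lrCross (a + t 0) (b + t 1) w h ↔ x ∈ lrCross a b w h := by
  simp only [lrCross, Set.mem_setOf_eq]
  refine Iff.symm ?_
  rw [blackEdges_shiftObs, ← preimage_relabel_openCrossing (Equiv.addRight t), Set.mem_preimage,
    image_addRight_setOf t fun x y => a ≤ x ∧ x < a + w ∧ b ≤ y ∧ y < b + h,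
    image_addRight_setOf t fun x y => x = a ∧ b ≤ y ∧ y < b + h,
    image_addRight_setOf t fun x y => x = a + w - 1 ∧ b ≤ y ∧ y < b + h]
  have e1 : {v : Site 2 | a ≤ v 0 - t 0 ∧ v 0 - t 0 < a + w ∧ b ≤ v 1 - t 1 ∧ v 1 - t 1 < b + h} =
      {v | a + t 0 ≤ v 0 ∧ v 0 < a + t 0 + w ∧ b + t 1 ≤ v 1 ∧ v 1 < b + t 1 + h} := by
    ext v; simp only [Set.mem_setOf_eq]; omega
  have e2 : {v : Site 2 | v 0 - t 0 = a ∧ b ≤ v 1 - t 1 ∧ v 1 - t 1 < b + h} =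
      {v | v 0 = a + t 0 ∧ b + t 1 ≤ v 1 ∧ v 1 < b + t 1 + h} := by
    ext v; simp only [Set.mem_setOf_eq]; omega
  have e3 : {v : Site 2 | v 0 - t 0 = a + w - 1 ∧ b ≤ v 1 - t 1 ∧ v 1 - t 1 < b + h} =
      {v | v 0 = a + t 0 + w - 1 ∧ b + t 1 ≤ v 1 ∧ v 1 < b + t 1 + h} := by
    ext v; simp only [Set.mem_setOf_eq]; omega
  rw [e1, e2, e3]

/-- SHIFT COVARIANCE of the bottom–top box crossing. [folklore] -/
theorem shiftObs_mem_tbCross (t : Site 2) (a b : ℤ) (w h : ℕ) (x : Obs) :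
    shiftObs t x ∈ tbCross (a + t 0) (b + t 1) w h ↔ x ∈ tbCross a b w h := by
  simp only [tbCross, Set.mem_setOf_eq]
  refine Iff.symm ?_
  rw [blackEdges_shiftObs, ← preimage_relabel_openCrossing (Equiv.addRight t), Set.mem_preimage,
    image_addRight_setOf t fun x y => a ≤ x ∧ x < a + w ∧ b ≤ y ∧ y < b + h,
    image_addRight_setOf t fun x y => y = b ∧ a ≤ x ∧ x < a + w,
    image_addRight_setOf t fun x y => y = b + h - 1 ∧ a ≤ x ∧ x < a + w]
  have e1 : {v : Site 2 | a ≤ v 0 - t 0 ∧ v 0 - t 0 < a + w ∧ b ≤ v 1 - t 1 ∧ v 1 - t 1 < b + h} =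
      {v | a + t 0 ≤ v 0 ∧ v 0 < a + t 0 + w ∧ b + t 1 ≤ v 1 ∧ v 1 < b + t 1 + h} := by
    ext v; simp only [Set.mem_setOf_eq]; omega
  have e2 : {v : Site 2 | v 1 - t 1 = b ∧ a ≤ v 0 - t 0 ∧ v 0 - t 0 < a + w} =
      {v | v 1 = b + t 1 ∧ a + t 0 ≤ v 0 ∧ v 0 < a + t 0 + w} := by
    ext v; simp only [Set.mem_setOf_eq]; omega
  have e3 : {v : Site 2 | v 1 - t 1 = b + h - 1 ∧ a ≤ v 0 - t 0 ∧ v 0 - t 0 < a + w} =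
      {v | v 1 = b + t 1 + h - 1 ∧ a + t 0 ≤ v 0 ∧ v 0 < a + t 0 + w} := by
    ext v; simp only [Set.mem_setOf_eq]; omega
  rw [e1, e2, e3]

/-! ## §B Horizontal re-anchoring of the gauge -/

/-- Shifting the anchored rectangle `[min 0 x, max 0 x) × B` horizontally by `m` changes the parity of
its marked points by that of the marked points of `[min 0 (-m), max 0 (-m)) × B` (the `x`-analogue of
the landed `odd_card_filter_shift`). [folklore] -/
theorem odd_card_filter_hshift (P : ℤ × ℤ → Prop) (B : Finset ℤ) (m x : ℤ) :
    Odd ((Finset.Ico (min 0 x) (max 0 x) ×ˢ B).filter (fun f => P (f.1 - m, f.2))).card ↔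
      Xor (Odd ((Finset.Ico (min 0 (x - m)) (max 0 (x - m)) ×ˢ B).filter P).card)
        (Odd ((Finset.Ico (min 0 (-m)) (max 0 (-m)) ×ˢ B).filter P).card) := by
  have cast : ∀ (s : Finset (ℤ × ℤ)) (Q : ℤ × ℤ → Prop), Odd (s.filter Q).card ↔
      (∑ f ∈ s, if Q f then (1 : ZMod 2) else 0) = 1 := fun s Q => by
    rw [← ZMod.natCast_eq_one_iff_odd, Finset.natCast_card_filter]
  have hx : ∀ a b : ZMod 2, Xor (a = 1) (b = 1) ↔ a + b = 1 := by decide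
  rw [cast, cast, cast, hx]
  refine Eq.congr_left ?_
  rw [Finset.sum_product_right, Finset.sum_product_right, Finset.sum_product_right,
    ← Finset.sum_add_distrib]
  refine Finset.sum_congr rfl fun b _ => ?_
  set h : ℤ → ZMod 2 := fun a => if P (a, b) then 1 else 0 with hh
  have hre : (∑ a ∈ Finset.Ico (min 0 x) (max 0 x),
      if P ((a, b).1 - m, (a, b).2) then (1 : ZMod 2) else 0) =
        ∑ a ∈ Finset.Ico (min (-m) (x - m)) (max (-m) (x - m)), h a := by
    have : Finset.Ico (min (-m) (x - m)) (max (-m) (x - m)) =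
        (Finset.Ico (min 0 x) (max 0 x)).map (addRightEmbedding (-m)) := by
      rw [Finset.map_add_right_Ico, ← min_add_add_right, ← max_add_add_right, zero_add,
        ← sub_eq_add_neg]
    rw [this, Finset.sum_map]
    simp [hh, sub_eq_add_neg]
  rw [hre, sum_Ico_minmax_chasles h (-m) 0 (x - m), min_comm (-m) 0, max_comm (-m) 0, add_comm]

/-- HORIZONTAL RE-ANCHORING: a `μIK`-preserving map of the bit space lifting the horizontal shift by `m`
of the observables, the column pattern being shifted along (shift the column bits, plaquettes and
coins; correct the row bits by the parity of the plaquettes in the rectangles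
`[min 0 (-m), max 0 (-m)) × [min 0 y, max 0 y)`). [folklore] -/
theorem exists_lift_hshift (S : Set ℤ) (m : ℤ) :
    ∃ Φ : Ω → Ω, MeasurePreserving Φ μIK μIK ∧
      ∀ ω, obs {x | x - m ∈ S} (Φ ω) = shiftObs ![m, 0] (obs S ω) := by
  let τ : Set ℤ → Set ℤ := SiteConfig.relabel (Equiv.addRight m)
  let τ₂ : Set (Site 2) → Set (Site 2) := SiteConfig.relabel (Equiv.addRight ![m, 0])
  let R : Type := Set (Site 2) × (Set (Site 2) × Set (Site 2))
  let D : R → Set ℤ := fun r => {y | Odd ((Finset.Ico (min 0 (-m)) (max 0 (-m)) ×ˢ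
      Finset.Ico (min 0 y) (max 0 y)).filter (fun f : ℤ × ℤ =>
        (![f.1, f.2] : Site 2) ∈ parSet S (((∅ : Set ℤ), ((∅ : Set ℤ), r)) : Ω))).card}
  let G : R → R := fun r => (τ₂ r.1, (τ₂ r.2.1, τ₂ r.2.2))
  have hDm : ∀ y : ℤ, Measurable fun r : R => y ∈ D r := fun y =>
    measurable_odd_card_filter (fun (f : ℤ × ℤ) =>
      ((measurable_obs' S).1 ![f.1, f.2]).comp
        (measurable_const.prodMk (measurable_const.prodMk measurable_id))) _
  have hgm : Measurable (uncurry fun (r : R) (b : Set ℤ) => b ∆ D r) := by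
    refine measurable_set_iff.2 fun y => ?_
    simp only [uncurry, Set.mem_symmDiff]
    have ha : Measurable fun p : R × Set ℤ => y ∈ p.2 := (measurable_set_mem y).comp measurable_snd
    have hd : Measurable fun p : R × Set ℤ => y ∈ D p.1 := (hDm y).comp measurable_fst
    exact (ha.and hd.not).or (hd.and ha.not)
  refine ⟨fun ω => (τ ω.1, (ω.2.1 ∆ D ω.2.2, G ω.2.2)), ?_, fun ω => ?_⟩
  · unfold μIK
    exact (measurePreserving_relabel _ _).prod (measurePreserving_swapSkew
      ((measurePreserving_relabel _ _).prod ((measurePreserving_relabel _ _).prod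
        (measurePreserving_relabel _ _))) hgm fun r => sitePercolation_half_map_symmDiff (D r))
  · -- the intertwining identity
    have hrel : ∀ (P : Set (Site 2)) (f : Site 2), f ∈ τ₂ P ↔ f - ![m, 0] ∈ P := fun P f => by
      simp only [τ₂, SiteConfig.mem_relabel_iff, Equiv.addRight_symm, Equiv.coe_addRight,
        sub_eq_add_neg]
    have hrel1 : ∀ (b : Set ℤ) (y : ℤ), y ∈ τ b ↔ y - m ∈ b := fun b y => by
      simp only [τ, SiteConfig.mem_relabel_iff, Equiv.addRight_symm, Equiv.coe_addRight,
        sub_eq_add_neg]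
    have hsub0 : ∀ f : Site 2, (f - ![m, 0]) 0 = f 0 - m := fun f => by
      simp only [Pi.sub_apply, Matrix.cons_val_zero]
    have hsub1 : ∀ f : Site 2, (f - ![m, 0]) 1 = f 1 := fun f => by
      simp only [Pi.sub_apply, Matrix.cons_val_one, Matrix.cons_val_zero, sub_zero]
    have hvec : ∀ a b : ℤ, (![a, b] : Site 2) - ![m, 0] = ![a - m, b] := fun a b => by
      simp only [Matrix.cons_sub_cons, Matrix.empty_sub_empty, sub_zero]
    have hpar : ∀ a b : ℤ, (![a, b] : Site 2) ∈ parSet {x | x - m ∈ S}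
        ((τ ω.1, (ω.2.1 ∆ D ω.2.2, G ω.2.2)) : Ω) ↔ (![a - m, b] : Site 2) ∈ parSet S ω :=
      fun a b => by simp only [parSet, Set.mem_setOf_eq, G, hrel, hvec, Matrix.cons_val_zero]
    have hD : parSet S (((∅ : Set ℤ), ((∅ : Set ℤ), ω.2.2)) : Ω) = parSet S ω := rfl
    refine Prod.ext ?_ ?_
    · ext v
      have key := odd_card_filter_hshift (fun g : ℤ × ℤ => (![g.1, g.2] : Site 2) ∈ parSet S ω)
        (Finset.Ico (min 0 (v 1)) (max 0 (v 1))) m (v 0)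
      dsimp only at key
      simp only [obs, shiftObs, Set.mem_preimage, blackSet, Set.mem_setOf_eq, hpar, hsub0, hsub1]
      simp only [hrel1, Set.mem_symmDiff, D, Set.mem_setOf_eq, hD]
      grind
    · ext f
      simp only [obs, shiftObs, Set.mem_preimage, antiSet, Set.mem_setOf_eq, G, hrel, hsub0]

/-! ## §C Measurability of the box events and transfer of probabilities along a lift -/

/-- TRANSFER: if a `μIK`-preserving `Φ` intertwines `obs S'` with `g ∘ obs S` and `g ⁻¹' E' = E`, then
`μIK (obs S ⁻¹' E) = μIK (obs S' ⁻¹' E')`. [folklore] -/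
theorem real_preimage_obs_eq {S S' : Set ℤ} {Φ : Ω → Ω} (hΦ : MeasurePreserving Φ μIK μIK)
    {g : Obs → Obs} (hobs : ∀ ω, obs S' (Φ ω) = g (obs S ω)) {E E' : Set Obs}
    (hE' : MeasurableSet E') (hg : ∀ x, g x ∈ E' ↔ x ∈ E) :
    μIK.real (obs S ⁻¹' E) = μIK.real (obs S' ⁻¹' E') := by
  have hset : obs S ⁻¹' E = Φ ⁻¹' (obs S' ⁻¹' E') := Set.ext fun ω => by
    simp only [Set.mem_preimage, hobs, hg]
  simp only [Measure.real, hset,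
    hΦ.measure_preimage ((measurable_obs' S').2.2 hE').nullMeasurableSet]

/-- RECENTRING: the box at `(a, b)` for the pattern `S` is crossed with the probability of the box at
the origin for the shifted pattern `{x | x + a ∈ S}`. [folklore] -/
theorem recentre (S : Set ℤ) (a b : ℤ) (w h : ℕ) :
    pLR S a b w h = pLR {x | x + a ∈ S} 0 0 w h ∧ pTB S a b w h = pTB {x | x + a ∈ S} 0 0 w h := by
  obtain ⟨Φ, hΦ, hobs⟩ := exists_lift_hshift S (-a)
  obtain ⟨Ψ, hΨ, hobs'⟩ := exists_lift_vshift {x | x + a ∈ S} (-b)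
  simp only [sub_neg_eq_add] at hobs
  simp only [vshift_eq_shiftObs] at hobs'
  have h1 : ∀ x, shiftObs ![-a, 0] x ∈ lrCross 0 b w h ↔ x ∈ lrCross a b w h := fun x => by
    simpa only [Matrix.cons_val_zero, Matrix.cons_val_one, add_neg_cancel, add_zero] using
      shiftObs_mem_lrCross ![-a, 0] a b w h x
  have h2 : ∀ x, shiftObs ![0, -b] x ∈ lrCross 0 0 w h ↔ x ∈ lrCross 0 b w h := fun x => by
    simpa only [Matrix.cons_val_zero, Matrix.cons_val_one, add_neg_cancel, add_zero] using
      shiftObs_mem_lrCross ![0, -b] 0 b w h x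
  have h3 : ∀ x, shiftObs ![-a, 0] x ∈ tbCross 0 b w h ↔ x ∈ tbCross a b w h := fun x => by
    simpa only [Matrix.cons_val_zero, Matrix.cons_val_one, add_neg_cancel, add_zero] using
      shiftObs_mem_tbCross ![-a, 0] a b w h x
  have h4 : ∀ x, shiftObs ![0, -b] x ∈ tbCross 0 0 w h ↔ x ∈ tbCross 0 b w h := fun x => by
    simpa only [Matrix.cons_val_zero, Matrix.cons_val_one, add_neg_cancel, add_zero] using
      shiftObs_mem_tbCross ![0, -b] 0 b w h x
  exact ⟨(real_preimage_obs_eq hΦ hobs (DualityStub.measurableSet_lrCross 0 b w h) h1).trans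
      (real_preimage_obs_eq hΨ hobs' (DualityStub.measurableSet_lrCross 0 0 w h) h2),
    (real_preimage_obs_eq hΦ hobs (DualityStub.measurableSet_tbCross 0 b w h) h3).trans
      (real_preimage_obs_eq hΨ hobs' (DualityStub.measurableSet_tbCross 0 0 w h) h4)⟩

/-! ## §D Origin pattern locality (pointwise) -/

section Origin

variable {T T' : Set ℤ} {w : ℕ} (hT : ∀ i : ℕ, i < w → ((i : ℤ) ∈ T ↔ (i : ℤ) ∈ T'))
  (ω : Ω)
include hT

/-- Patterns agreeing on `[0, w)` agree at every integer of `[0, w)`. [folklore] -/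
theorem mem_congr_of_lt {z : ℤ} (h0 : 0 ≤ z) (hw : z < w) : z ∈ T ↔ z ∈ T' := by
  obtain ⟨i, rfl⟩ : ∃ i : ℕ, (i : ℤ) = z := ⟨z.toNat, Int.toNat_of_nonneg h0⟩
  exact hT i (by omega)

/-- The colours of the cells of the columns `0 … w-1` only read the pattern on `[0, w)`. [folklore] -/
theorem mem_blackSet_congr {v : Site 2} (h0 : 0 ≤ v 0) (hw : v 0 < w) :
    v ∈ blackSet T ω ↔ v ∈ blackSet T' ω := by
  have hfil : (Finset.Ico (min 0 (v 0)) (max 0 (v 0)) ×ˢ Finset.Ico (min 0 (v 1)) (max 0 (v 1))).filter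
      (fun f : ℤ × ℤ => (![f.1, f.2] : Site 2) ∈ parSet T ω) =
      (Finset.Ico (min 0 (v 0)) (max 0 (v 0)) ×ˢ Finset.Ico (min 0 (v 1)) (max 0 (v 1))).filter
        (fun f : ℤ × ℤ => (![f.1, f.2] : Site 2) ∈ parSet T' ω) := by
    refine Finset.filter_congr fun f hf => ?_
    have hf' : 0 ≤ f.1 ∧ f.1 < w := by
      simp only [Finset.mem_product, Finset.mem_Ico] at hf; omega
    simp only [parSet, Set.mem_setOf_eq, Matrix.cons_val_zero, mem_congr_of_lt hT hf'.1 hf'.2]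
  simp only [blackSet, Set.mem_setOf_eq, hfil]

/-- The diagonal flags of the faces of the columns `0 … w-1` only read the pattern on `[0, w)`.
[folklore] -/
theorem mem_antiSet_congr {f : Site 2} (h0 : 0 ≤ f 0) (hw : f 0 < w) :
    f ∈ antiSet T ω ↔ f ∈ antiSet T' ω := by
  simp only [antiSet, Set.mem_setOf_eq, mem_congr_of_lt hT h0 hw]

/-- The open edges between cells of the columns `0 … w-1` only read the pattern on `[0, w)`.
[folklore] -/
theorem mk_mem_blackEdges_obs_congr {u v : Site 2} (hu : 0 ≤ u 0 ∧ u 0 < w)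
    (hv : 0 ≤ v 0 ∧ v 0 < w) :
    s(u, v) ∈ blackEdges (obs T ω) ↔ s(u, v) ∈ blackEdges (obs T' ω) := by
  have hu1 : (u + ![0, -1] : Site 2) 0 = u 0 := by
    simp only [Pi.add_apply, Matrix.cons_val_zero, add_zero]
  have hv1 : (v + ![0, -1] : Site 2) 0 = v 0 := by
    simp only [Pi.add_apply, Matrix.cons_val_zero, add_zero]
  rw [CouplingToLimits.mk_mem_blackEdges_iff, CouplingToLimits.mk_mem_blackEdges_iff]
  simp only [obs, mem_blackSet_congr hT ω hu.1 hu.2, mem_blackSet_congr hT ω hv.1 hv.2,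
    mem_antiSet_congr hT ω hu.1 hu.2, mem_antiSet_congr hT ω hv.1 hv.2,
    mem_antiSet_congr hT ω (hu1.symm ▸ hu.1) (hu1.symm ▸ hu.2),
    mem_antiSet_congr hT ω (hv1.symm ▸ hv.1) (hv1.symm ▸ hv.2)]

omit hT in
/-- Open crossings inside `X` only read the edges with both ends in `X`. [folklore] -/
theorem mem_openCrossing_congr {V : Type*} {ξ ξ' : BondConfig V} {X A B : Set V}
    (h : ∀ u ∈ X, ∀ v ∈ X, (s(u, v) ∈ ξ ↔ s(u, v) ∈ ξ')) :
    ξ ∈ openCrossing X A B ↔ ξ' ∈ openCrossing X A B := by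
  have hG : (openGraph ξ).induce X = (openGraph ξ').induce X := by
    ext p q
    simp only [SimpleGraph.induce_adj, openGraph_adj, h p.1 p.2 q.1 q.2]
  simp only [mem_openCrossing_iff, openConnIn, Set.mem_setOf_eq, hG]

/-- ORIGIN PATTERN LOCALITY: for the gauge anchored at the origin, the crossings of the box
`[0, w) × [b, b+h)` only read the pattern of `S` on `[0, w)`. [folklore] -/
theorem obs_mem_cross_congr (b : ℤ) (h : ℕ) :
    (obs T ω ∈ lrCross 0 b w h ↔ obs T' ω ∈ lrCross 0 b w h) ∧
      (obs T ω ∈ tbCross 0 b w h ↔ obs T' ω ∈ tbCross 0 b w h) := by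
  have key : ∀ u ∈ {v : Site 2 | 0 ≤ v 0 ∧ v 0 < 0 + w ∧ b ≤ v 1 ∧ v 1 < b + h},
      ∀ v ∈ {v : Site 2 | 0 ≤ v 0 ∧ v 0 < 0 + w ∧ b ≤ v 1 ∧ v 1 < b + h},
        (s(u, v) ∈ blackEdges (obs T ω) ↔ s(u, v) ∈ blackEdges (obs T' ω)) := fun u hu v hv =>
    mk_mem_blackEdges_obs_congr hT ω ⟨hu.1, by simpa only [zero_add] using hu.2.1⟩
      ⟨hv.1, by simpa only [zero_add] using hv.2.1⟩
  exact ⟨mem_openCrossing_congr key, mem_openCrossing_congr key⟩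

end Origin

end StubPatternLocality

open StubPatternLocality in
/-- **STUB 1 · `stub_patternLocality`** (= `PatternLocality`): the box-crossing probabilities depend on
`(S, a, b)` only through the column pattern `i ↦ (a + i ∈ S)`, `i < w` (recentring by the horizontal and
vertical re-anchorings of the gauge, then origin pattern locality). [folklore] -/
theorem stub_patternLocality :
    ∀ (S S' : Set ℤ) (a a' b b' : ℤ) (w h : ℕ), (∀ i : ℕ, i < w → (a + i ∈ S ↔ a' + i ∈ S')) →
      pLR S a b w h = pLR S' a' b' w h ∧ pTB S a b w h = pTB S' a' b' w h := by
  intro S S' a a' b b' w h hpat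
  have hT : ∀ i : ℕ, i < w →
      ((i : ℤ) ∈ {x : ℤ | x + a ∈ S} ↔ (i : ℤ) ∈ {x : ℤ | x + a' ∈ S'}) := fun i hi => by
    simpa only [Set.mem_setOf_eq, add_comm (i : ℤ)] using hpat i hi
  obtain ⟨h1, h2⟩ := recentre S a b w h
  obtain ⟨h1', h2'⟩ := recentre S' a' b' w h
  rw [h1, h2, h1', h2']
  exact ⟨congrArg μIK.real (Set.ext fun ω => (obs_mem_cross_congr hT ω 0 h).1),
    congrArg μIK.real (Set.ext fun ω => (obs_mem_cross_congr hT ω 0 h).2)⟩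

end Summit.CriticalPhenomena.CardyFormulaZ2.Cruxes.IKMixedBoxCrossing.PairedMirrorExploration

end
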